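import Literature.NumberTheory.GaloisCohomology.RestrictedRamificationFiniteCoefficients
import Literature.NumberTheory.GaloisCohomology.RestrictedRamificationFiniteCohomologyOfTateEuler
import HarnessLib

/-!
# Finiteness of `Hⁿ(G_{K,S}, A)` in degrees `n ≤ 2` for a finite `Λ[G_{K,S}]`-module `A` killed by
# `p`, from Tate's global Euler–Poincaré characteristic ALONE (every number field)

Topic `NumberTheory/GaloisCohomology`; namespace `Literature.NumberTheory.GaloisCohomology`.
THEOREMS ONLY (no definition, no named fact, no `sorry`, no instance).

Greenberg (*On the structure of certain Galois cohomology groups*, Doc. Math. 2006, §3 p. 358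
L8–13) works under the standing hypothesis (F): "the cohomology groups `Hⁱ(G, α_k)` are finite for
all `i ≥ 0` … This is so if … (ii) `G = Gal(K_Σ/K)`".  The sibling file
`RestrictedRamificationFiniteCoefficients` supplies (F) (ii) in EVERY degree from the named fact
`finite_restrictedCohomology K` (Harari Cor. 17.17 = NSW (8.3.20) (i)), which the tree derives from
the TWO textbook named facts Milne I Thm. 5.1 (`tateGlobalEulerPoincareCharacteristic K`) and
Harari Thm. 17.13 (a) (`poitouTate_restricted_three_le K`, needed in degrees `≥ 3` only).

This file records that **in degrees `n ≤ 2` hypothesis (F) (ii) follows from Tate's formula alone**,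
for every number field `K` (no Poitou–Tate input, no condition at the real places):
`H⁰(G_S, ·)` and `H¹(G_S, ·)` are finite unconditionally (`finite_restrictedCohomology_zero`,
`finite_restrictedCohomology_one` — Hermite), and `H²(G_S, M)` is finite granted Tate's identity as
typed (`finite_restrictedCohomology_two_of_tateGlobalEulerPoincareCharacteristic`: the identity is a
`Nat.card` identity whose right-hand side is non-zero).  Transported to Greenberg's `Λ`-linear
currency `continuousCohomology n τ.toTopRep` along the sibling file's inflation bridge
`nonempty_restrictedCohomology_addEquiv_H` (`Hⁿ(G_S, A^{N_S}) ≃+ Hⁿ(G_{K,S}, A)`):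

* `finite_continuousCohomology_of_tate_le_two` — `A` finite with every finite place dividing `#A`
  in `S`, `n ≤ 2`;
* `finite_continuousCohomology_of_prime_of_tate_le_two` — `A` finite killed by a prime `p`,
  `S ∋` every `v ∣ p`, `n ≤ 2`;
* `hypothesisF_le_two_galoisGroupUnramifiedOutside_of_tate` — Greenberg's hypothesis (F) (ii) IN
  DEGREES `≤ 2`, in the binder shape of the degree-truncated Prop. 3.2
  `ContinuousRep.module_finite_characterModule_continuousCohomology_of_le` (its `hΓ` with `N = 2`),
  for any ideal `I ∋ p` of the coefficient ring.

Use (sequel `Greenberg2006/CohomologyCofiniteGenerationLeTwoOfTate`): Greenberg 2006 Prop. 3.2 in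
degrees `≤ 2` — the only degrees its consumers on the Eisenstein-primes line read — from Milne I
Thm. 5.1 alone.

## References
* R. Greenberg, *On the structure of certain Galois cohomology groups*, Doc. Math. Extra Vol.
  Coates (2006) 335–391, §3 (p. 358 L3–13). [Greenberg2006]
* J. S. Milne, *Arithmetic Duality Theorems*, 2nd ed. (2006), I Thm. 5.1 (p. 67), I Cor. 4.15
  (p. 61). [MilneADT2006]
* D. Harari, *Galois Cohomology and Class Field Theory*, Universitext (2020), Cor. 17.17 (p. 295).
  [Harari2020]
* J. Neukirch, A. Schmidt, K. Wingberg, *Cohomology of Number Fields*, 2nd ed. (2008), (8.3.20).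
  [NeukirchSchmidtWingberg2008]
-/

noncomputable section

open Function NumberField Field IsDedekindDomain
open scoped NumberField

namespace Literature.NumberTheory.GaloisCohomology

open Literature.NumberTheory.GaloisRepresentations
open Literature.NumberTheory.GaloisRepresentations.DiscreteGaloisModule (restrictedCohomology)

variable {K : Type} [Field K] [NumberField K] (S : Set (HeightOneSpectrum (𝓞 K)))
variable {Λ : Type} [CommRing Λ] [TopologicalSpace Λ]
variable {A : Type} [AddCommGroup A] [Module Λ A] [TopologicalSpace A] [DiscreteTopology A]
  [ContinuousSMul Λ A]
variable (τ : ContinuousRep (GaloisGroupUnramifiedOutside K S) Λ A)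

/-! ### §1. Degrees `≤ 2` in the fact's currency, from Tate's formula alone -/

omit [TopologicalSpace Λ] [ContinuousSMul Λ A] in
/-- **`Hⁿ(G_S, M^{N_S})` is finite for `n ≤ 2`**, for `S` a finite set of finite places and `M` a
finite discrete `Γ_K`-module unramified outside `S` with every finite place dividing `#M` in `S`,
GRANTED Tate's global Euler–Poincaré characteristic formula for `K` as typed (degree `2`); degrees
`0` and `1` are unconditional (invariants of a finite module; Hermite).
[cite: MilneADT2006, Ch. I §5, Thm. 5.1 (p. 67) and Cor. 4.15 (p. 61)]
[cite: Harari2020, Cor. 17.17 (p. 295)] -/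
theorem finite_restrictedCohomology_of_tate_le_two (hT : tateGlobalEulerPoincareCharacteristic K)
    {S : Set (HeightOneSpectrum (𝓞 K))} (hS : S.Finite) {M : Type} [AddCommGroup M]
    [TopologicalSpace M] [DiscreteTopology M] [Finite M] (ρ : DiscreteGaloisModule K M)
    (hur : GaloisRep.IsUnramifiedOutside S ρ)
    (hcard : ∀ v : HeightOneSpectrum (𝓞 K), ((Nat.card M : ℕ) : 𝓞 K) ∈ v.asIdeal → v ∈ S)
    {n : ℕ} (hn : n ≤ 2) : Finite (restrictedCohomology ρ S n) := by
  match n, hn with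
  | 0, _ => exact finite_restrictedCohomology_zero S ρ
  | 1, _ => exact finite_restrictedCohomology_one hS ρ
  | 2, _ => exact finite_restrictedCohomology_two_of_tateGlobalEulerPoincareCharacteristic hT hS ρ hur hcard

/-! ### §2. Transport to Greenberg's `Λ`-linear currency `Hⁿ(G_{K,S}, A)` -/

/-- **`Hⁿ(G_{K,S}, A)` is finite for `n ≤ 2`**, for `S` finite and `A` a finite discrete
`Λ[G_{K,S}]`-module with every finite place dividing `#A` in `S`, GRANTED Tate's global
Euler–Poincaré characteristic formula for `K` (Milne I Thm. 5.1) — and nothing in degrees `≥ 3`.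
The inflated `Γ_K`-module is unramified outside `S` (`isUnramifiedOutside_inflate`) and
`Hⁿ(G_S, A^{N_S}) ≃+ Hⁿ(G_{K,S}, A)` (`nonempty_restrictedCohomology_addEquiv_H`).
[cite: MilneADT2006, Ch. I §5, Thm. 5.1 (p. 67)] [cite: Harari2020, Cor. 17.17 (p. 295)]
[cite: Greenberg2006, §3 (p. 358 L8–13)] -/
theorem finite_continuousCohomology_of_tate_le_two (hT : tateGlobalEulerPoincareCharacteristic K)
    (hS : S.Finite) [Finite A]
    (hcard : ∀ v : HeightOneSpectrum (𝓞 K), ((Nat.card A : ℕ) : 𝓞 K) ∈ v.asIdeal → v ∈ S)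
    {n : ℕ} (hn : n ≤ 2) : Finite (continuousCohomology n τ.toTopRep) := by
  haveI : Finite (restrictedCohomology
      ((τ.restrictScalars ℤ).restrict (toUnramifiedQuotCont K S)) S n) :=
    finite_restrictedCohomology_of_tate_le_two hT hS _ (isUnramifiedOutside_inflate S τ) hcard hn
  obtain ⟨e⟩ := nonempty_restrictedCohomology_addEquiv_H S τ n
  exact Finite.of_equiv _ e.toEquiv

omit [TopologicalSpace Λ] [TopologicalSpace A] [DiscreteTopology A] [ContinuousSMul Λ A]
  [NumberField K] in
/-- If `A` is finite and killed by the prime `p`, every finite place dividing `#A` divides `p`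
(`#A` is a power of `p`). [folklore] -/
private theorem mem_of_prime_smul_eq_zero_of_natCard_mem (p : ℕ) [Fact p.Prime] [Finite A]
    (hp : ∀ a : A, (p : Λ) • a = 0)
    (hS : ∀ v : HeightOneSpectrum (𝓞 K), ((p : ℕ) : 𝓞 K) ∈ v.asIdeal → v ∈ S)
    (v : HeightOneSpectrum (𝓞 K)) (hv : ((Nat.card A : ℕ) : 𝓞 K) ∈ v.asIdeal) : v ∈ S := by
  have hG : IsPGroup p (Multiplicative A) := by
    intro g
    refine ⟨1, ?_⟩
    rw [pow_one]
    change Multiplicative.ofAdd (p • (Multiplicative.toAdd g)) = Multiplicative.ofAdd 0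
    congr 1
    rw [← Nat.cast_smul_eq_nsmul Λ]
    exact hp _
  obtain ⟨k, hk⟩ := IsPGroup.iff_card.mp hG
  have hk' : Nat.card A = p ^ k := by rw [← hk]; rfl
  rw [hk', Nat.cast_pow] at hv
  exact hS v (v.isPrime.mem_of_pow_mem _ hv)

/-- **`Hⁿ(G_{K,S}, A)` is finite for `n ≤ 2`, `A` finite killed by `p` and `S` finite containing
the places above `p`**, granted Tate's formula for `K` only. This is Greenberg's "(ii)
`G = Gal(K_Σ/K)`" for the `p`-torsion coefficient modules `α_k`, `D[𝔪]`, … of §3, in the degrees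
`0, 1, 2`. [cite: Greenberg2006, §3 (p. 358 L8–13)] [cite: MilneADT2006, Ch. I §5, Thm. 5.1 (p. 67)] -/
theorem finite_continuousCohomology_of_prime_of_tate_le_two
    (hT : tateGlobalEulerPoincareCharacteristic K) (hS : S.Finite) (p : ℕ) [Fact p.Prime]
    (hSp : ∀ v : HeightOneSpectrum (𝓞 K), ((p : ℕ) : 𝓞 K) ∈ v.asIdeal → v ∈ S) [Finite A]
    (hp : ∀ a : A, (p : Λ) • a = 0) {n : ℕ} (hn : n ≤ 2) :
    Finite (continuousCohomology n τ.toTopRep) :=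
  finite_continuousCohomology_of_tate_le_two S τ hT hS
    (mem_of_prime_smul_eq_zero_of_natCard_mem S (Λ := Λ) (A := A) p hp hSp) hn

/-- **Greenberg's standing hypothesis (F), case (ii) `G = Gal(K_Σ/K)`, IN DEGREES `≤ 2`**, in the
binder shape consumed by the degree-truncated Prop. 3.2
`ContinuousRep.module_finite_characterModule_continuousCohomology_of_le` (its `hΓ`, `N = 2`): for
`S` finite containing the places above `p` and ANY ideal `I` of the coefficient ring containing `p`,
every finite discrete `Λ[G_{K,S}]`-module killed by `I` has finite cohomology in degrees `≤ 2` —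
GRANTED only Tate's global Euler–Poincaré characteristic for `K` (Milne I Thm. 5.1).
[cite: Greenberg2006, §3 (p. 358 L8–13)] [cite: MilneADT2006, Ch. I §5, Thm. 5.1 (p. 67)] -/
theorem hypothesisF_le_two_galoisGroupUnramifiedOutside_of_tate
    (hT : tateGlobalEulerPoincareCharacteristic K) (hS : S.Finite) (p : ℕ) [Fact p.Prime]
    (hSp : ∀ v : HeightOneSpectrum (𝓞 K), ((p : ℕ) : 𝓞 K) ∈ v.asIdeal → v ∈ S)
    (I : Ideal Λ) (hpI : (p : Λ) ∈ I) :
    ∀ (B : Type) [AddCommGroup B] [Module Λ B] [TopologicalSpace B] [DiscreteTopology B]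
      [ContinuousSMul Λ B] [Finite B] (υ : ContinuousRep (GaloisGroupUnramifiedOutside K S) Λ B),
      (∀ r ∈ I, ∀ b : B, r • b = 0) → ∀ n ≤ 2, Finite (continuousCohomology n υ.toTopRep) := by
  intro B _ _ _ _ _ _ υ hI n hn
  exact finite_continuousCohomology_of_prime_of_tate_le_two S υ hT hS p hSp (fun b => hI _ hpI b) hn

end Literature.NumberTheory.GaloisCohomology

end
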